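import Mathlib
import HarnessLib

/-!
# Crux `MatrixDescartes` (stmt-ValiantsHypothesis-18050, the summit's V1), line
# `Cruxes/MatrixDescartes/Lines/lorentzian_shadow.lean`, toward the KNOWN stub `stub_detLorentzian` —
# [M1] the discrete-convexity half of clause (c): integer points of a submodular base polytope are M-convex

HONEST FRAMING.  Helper lemmas (`--supports stmt-ValiantsHypothesis-18050 --as helper`; merged desk, CLAIM-FIRST #3
of val-lit-p7 g10, 2026-08-28) on a registered ALTERNATIVE line of V1; pure finite combinatorics, 0 definitions /
0 named facts.  Clause (c) of `IsLorentzianArray m K (detArray m K A)` (M-convex support) is NOT proved here: what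
remains is the identification `supp (detArray A) = {α ∈ Δ(m,K) | ∀ S, Σ_{l∈S} α_l ≤ rank (Σ_{l∈S} A_l)}` for
`A_l ⪰ 0` (necessity: Cauchy–Binet; sufficiency: Rado's theorem / matroid intersection with the colour partition —
Panov's criterion for mixed discriminants), after which `polymatroid_isMConvexOn_layer` below with the submodular
`f S = rank (Σ_{l∈S} A_l)` IS clause (c).  `stub_detLorentzian` ((c) and the Hessian clause (d)), the law stubs,
`MatrixDescartes`, Conjecture B and `VP ≠ VNP` are all OPEN; nothing here bears on them.

* `tight_union_inter` — tight sets (`x(S) = f(S)`) of a point of `P(f)` are closed under `∪`, `∩`.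
* `polymatroid_exchange` — the tight-set exchange lemma: `y i < x i` ⇒ some `j` with `x j < y j` is separated
  from `i` by no `x`-tight set (`j ∈ S ∌ i`) and by no `y`-tight set (`i ∈ S ∌ j`)  (take `j ∈ T ∖ U`, `T` the
  least `y`-tight set containing `i`, `U` the largest `x`-tight set avoiding `i`; submodularity).
* `sum_exch_add`, `exch_mem_of_separation` — the exchanged point `x − e_i + e_j` (the line's `exch`, truncated
  subtraction) stays in `B(f)`.
* **`polymatroid_isMConvex`** (membership-characterised `D`) and **`polymatroid_isMConvexOn_layer`** (the line's
  `IsMConvexOn ((layer (f univ) K).filter (∀ S, α(S) ≤ f S)) (fun _ => 0)` with `layer`/`exch` UNFOLDED).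
[Murota, Discrete Convex Analysis (SIAM 2003), §4.4 "base polyhedra and M-convex sets"; folklore]
-/

set_option linter.dupNamespace false
set_option autoImplicit false

namespace Summit.ValiantsHypothesis.ValiantsHypothesis.Theorems.LacunarySymmetroidMatrixDescartes

namespace DetLorentzian

open Finset

variable {K : ℕ}

/-- Tight sets of a point of a submodular polytope are closed under `∪` and `∩`. [folklore] -/
theorem tight_union_inter (f : Finset (Fin K) → ℕ)
    (hsub : ∀ S T, f (S ∪ T) + f (S ∩ T) ≤ f S + f T) (x : Fin K → ℕ) (hx : ∀ S, ∑ l ∈ S, x l ≤ f S)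
    {S T : Finset (Fin K)} (hS : ∑ l ∈ S, x l = f S) (hT : ∑ l ∈ T, x l = f T) :
    ∑ l ∈ S ∪ T, x l = f (S ∪ T) ∧ ∑ l ∈ S ∩ T, x l = f (S ∩ T) := by
  have hmod : ∑ l ∈ S ∪ T, x l + ∑ l ∈ S ∩ T, x l = ∑ l ∈ S, x l + ∑ l ∈ T, x l :=
    Finset.sum_union_inter
  have h1 := hx (S ∪ T)
  have h2 := hx (S ∩ T)
  have h3 := hsub S T
  constructor <;> omega

/-- **Two-sided exchange in an integral submodular base polytope (tight-set argument).**  For `f` submodular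
with `f ∅ = 0`, an integer point `x` of the polytope `P(f) = {z ≥ 0 | z(S) ≤ f(S) ∀ S}`, an integer point `y`
of its base `B(f) = P(f) ∩ {z(univ) = f(univ)}` and a coordinate `i` with `y i < x i`, there is `j` with `x j < y j` such that no `x`-tight set contains `j` but not
`i` and no `y`-tight set contains `i` but not `j` (take `j` in `T \\ U`, `T` the least `y`-tight set
containing `i`, `U` the largest `x`-tight set avoiding `i`). [Murota, Discrete Convex Analysis (2003), §4.4
(base polyhedra are M-convex); folklore] -/
theorem polymatroid_exchange (f : Finset (Fin K) → ℕ)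
    (hsub : ∀ S T, f (S ∪ T) + f (S ∩ T) ≤ f S + f T) (h0 : f ∅ = 0)
    (x y : Fin K → ℕ) (hx : ∀ S, ∑ l ∈ S, x l ≤ f S)
    (hy : ∀ S, ∑ l ∈ S, y l ≤ f S) (hyu : ∑ l, y l = f univ) (i : Fin K) (hi : y i < x i) :
    ∃ j, x j < y j ∧ (∀ S, j ∈ S → i ∉ S → ∑ l ∈ S, x l < f S) ∧
      (∀ S, i ∈ S → j ∉ S → ∑ l ∈ S, y l < f S) := by
  classical
  -- `T` : the least `y`-tight set containing `i`
  set Fy : Finset (Finset (Fin K)) := univ.filter (fun S => ∑ l ∈ S, y l = f S ∧ i ∈ S) with hFy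
  set T : Finset (Fin K) := Fy.inf id with hTdef
  have hT : ∑ l ∈ T, y l = f T ∧ i ∈ T := by
    refine Finset.inf_induction (p := fun S : Finset (Fin K) => ∑ l ∈ S, y l = f S ∧ i ∈ S) ?_ ?_ ?_
    · exact ⟨by simpa using hyu, by simp⟩
    · intro a ha b hb
      exact ⟨(tight_union_inter f hsub y hy ha.1 hb.1).2, by simpa using And.intro ha.2 hb.2⟩
    · intro S hS
      simpa [hFy] using hS
  have hTmin : ∀ S, ∑ l ∈ S, y l = f S → i ∈ S → T ⊆ S := fun S h1 h2 =>
    Finset.inf_le (f := id) (by simp [hFy, h1, h2])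
  -- `U` : the largest `x`-tight set avoiding `i`
  set Fx : Finset (Finset (Fin K)) := univ.filter (fun S => ∑ l ∈ S, x l = f S ∧ i ∉ S) with hFx
  set U : Finset (Fin K) := Fx.sup id with hUdef
  have hU : ∑ l ∈ U, x l = f U ∧ i ∉ U := by
    refine Finset.sup_induction (p := fun S : Finset (Fin K) => ∑ l ∈ S, x l = f S ∧ i ∉ S) ?_ ?_ ?_
    · exact ⟨by simpa using h0.symm, by simp⟩
    · intro a ha b hb
      exact ⟨(tight_union_inter f hsub x hx ha.1 hb.1).1, by simpa using And.intro ha.2 hb.2⟩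
    · intro S hS
      simpa [hFx] using hS
  have hUmax : ∀ S, ∑ l ∈ S, x l = f S → i ∉ S → S ⊆ U := fun S h1 h2 =>
    Finset.le_sup (f := id) (by simp [hFx, h1, h2])
  -- some `j ∈ T \ U` has `x j < y j`
  have key : ∃ j, j ∈ T ∧ j ∉ U ∧ x j < y j := by
    by_contra hne
    push Not at hne
    have hlt : ∑ l ∈ T \ U, y l < ∑ l ∈ T \ U, x l :=
      Finset.sum_lt_sum (fun l hl => hne l (mem_sdiff.1 hl).1 (mem_sdiff.1 hl).2)
        ⟨i, mem_sdiff.2 ⟨hT.2, hU.2⟩, hi⟩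
    have hxTU : ∑ l ∈ U ∪ T, x l = ∑ l ∈ U, x l + ∑ l ∈ T \ U, x l := by
      rw [← union_sdiff_self_eq_union, sum_union disjoint_sdiff]
    have hyT : ∑ l ∈ T ∩ U, y l + ∑ l ∈ T \ U, y l = ∑ l ∈ T, y l := Finset.sum_inter_add_sum_sdiff T U y
    have h1 := hx (U ∪ T)
    have h2 := hy (T ∩ U)
    have h3 : f (U ∪ T) + f (T ∩ U) ≤ f U + f T := by simpa [inter_comm] using hsub U T
    have h4 := hU.1
    have h5 := hT.1
    omega
  obtain ⟨j, hjT, hjU, hj⟩ := key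
  refine ⟨j, hj, fun S hjS hiS => ?_, fun S hiS hjS => ?_⟩
  · rcases (hx S).lt_or_eq with h | h
    · exact h
    · exact absurd (hUmax S h hiS hjS) hjU
  · rcases (hy S).lt_or_eq with h | h
    · exact h
    · exact absurd (hTmin S h hiS hjT) hjS

/-- Sums of the exchanged point `x − e_i + e_j` (truncated subtraction, `x i ≥ 1`), in additive form.
[folklore] -/
theorem sum_exch_add (x : Fin K → ℕ) (i j : Fin K) (hi : 1 ≤ x i) (S : Finset (Fin K)) :
    ∑ l ∈ S, (x - Pi.single i 1 + Pi.single j 1 : Fin K → ℕ) l + (if i ∈ S then 1 else 0) =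
      ∑ l ∈ S, x l + (if j ∈ S then 1 else 0) := by
  classical
  have hsi : ∑ l ∈ S, (Pi.single i 1 : Fin K → ℕ) l = if i ∈ S then 1 else 0 := by
    simp only [Pi.single_apply, Finset.sum_ite_eq']
  have hsj : ∑ l ∈ S, (Pi.single j 1 : Fin K → ℕ) l = if j ∈ S then 1 else 0 := by
    simp only [Pi.single_apply, Finset.sum_ite_eq']
  have hle : ∀ l, (Pi.single i 1 : Fin K → ℕ) l ≤ x l := by
    intro l
    by_cases h : l = i
    · subst h; simpa using hi
    · simp [h]
  have hsub : ∑ l ∈ S, (x - Pi.single i 1 : Fin K → ℕ) l + ∑ l ∈ S, (Pi.single i 1 : Fin K → ℕ) l = ∑ l ∈ S, x l := by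
    rw [← Finset.sum_add_distrib]
    exact Finset.sum_congr rfl fun l _ => by rw [Pi.sub_apply, tsub_add_cancel_of_le (hle l)]
  rw [← hsi, ← hsj, ← hsub]
  simp only [Pi.add_apply, Finset.sum_add_distrib]
  ring

/-- Membership of the exchanged point in the base polytope from the separation property of
`polymatroid_exchange`. [folklore] -/
theorem exch_mem_of_separation (f : Finset (Fin K) → ℕ) (x : Fin K → ℕ)
    (hx : ∀ S, ∑ l ∈ S, x l ≤ f S) (hxu : ∑ l, x l = f univ) (i j : Fin K) (hi : 1 ≤ x i)
    (hsep : ∀ S, j ∈ S → i ∉ S → ∑ l ∈ S, x l < f S) :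
    (∀ S, ∑ l ∈ S, (x - Pi.single i 1 + Pi.single j 1 : Fin K → ℕ) l ≤ f S) ∧
      ∑ l, (x - Pi.single i 1 + Pi.single j 1 : Fin K → ℕ) l = f univ := by
  refine ⟨fun S => ?_, ?_⟩
  · have h := sum_exch_add x i j hi S
    by_cases hjS : j ∈ S
    · by_cases hiS : i ∈ S
      · have := hx S
        simp only [hjS, hiS, if_true] at h
        omega
      · have := hsep S hjS hiS
        simp only [hjS, hiS, if_true, if_false] at h
        omega
    · have := hx S
      by_cases hiS : i ∈ S
      · simp only [hjS, hiS, if_true, if_false] at h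
        omega
      · simp only [hjS, hiS, if_false] at h
        omega
  · have h := sum_exch_add x i j hi univ
    simp only [mem_univ, if_true] at h
    omega

/-- **[M1] Integer points of a submodular base polytope form an M-convex set** (the exchange axiom of the
line's `IsMConvexOn D (fun _ => 0)`, with `exch α i j = α - Pi.single i 1 + Pi.single j 1`):  for `f` submodular
on the subsets of `Fin K` with `f ∅ = 0` and `D` the set of `α : Fin K → ℕ` with `α(S) ≤ f(S)` for all `S`
and `α(univ) = f(univ)`, any `α, β ∈ D` and `i` with `β i < α i` admit `j` with `α j < β j`,
`α − e_i + e_j ∈ D` and `β − e_j + e_i ∈ D`.  (Consumer: clause (c) of `stub_detLorentzian` once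
`supp (detArray A) = D` for `f S = rank (Σ_{l ∈ S} A_l)` — Rado / Panov, the residual.)
[Murota, Discrete Convex Analysis (2003), §4.4; folklore] -/
theorem polymatroid_isMConvex (f : Finset (Fin K) → ℕ)
    (hsub : ∀ S T, f (S ∪ T) + f (S ∩ T) ≤ f S + f T) (h0 : f ∅ = 0) (D : Finset (Fin K → ℕ))
    (hD : ∀ α, α ∈ D ↔ (∀ S, ∑ l ∈ S, α l ≤ f S) ∧ ∑ l, α l = f univ) :
    ∀ α ∈ D, ∀ β ∈ D, ∀ i : Fin K, β i < α i →
      ∃ j : Fin K, α j < β j ∧ (α - Pi.single i 1 + Pi.single j 1) ∈ D ∧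
        (β - Pi.single j 1 + Pi.single i 1) ∈ D := by
  intro α hα β hβ i hi
  obtain ⟨hα1, hα2⟩ := (hD α).1 hα
  obtain ⟨hβ1, hβ2⟩ := (hD β).1 hβ
  obtain ⟨j, hj, hsepα, hsepβ⟩ := polymatroid_exchange f hsub h0 α β hα1 hβ1 hβ2 i hi
  refine ⟨j, hj, (hD _).2 (exch_mem_of_separation f α hα1 hα2 i j (by omega) hsepα),
    (hD _).2 (exch_mem_of_separation f β hβ1 hβ2 j i (by omega) hsepβ)⟩

/-- The same for the line's concrete currency: `D = (layer n K).filter (∀ S, α(S) ≤ f S)` with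
`layer n K = (piFinset fun _ => range (n+1)).filter (Σ α = n)` UNFOLDED and `n = f univ`; the conclusion is the
line's `IsMConvexOn D (fun _ => (0 : ℚ))` unfolded (the `ν`-inequality is `0 + 0 ≤ 0 + 0`). [folklore] -/
theorem polymatroid_isMConvexOn_layer (f : Finset (Fin K) → ℕ)
    (hsub : ∀ S T, f (S ∪ T) + f (S ∩ T) ≤ f S + f T) (h0 : f ∅ = 0) :
    ∀ α ∈ ((Fintype.piFinset fun _ : Fin K => Finset.range (f univ + 1)).filter
        (fun α => ∑ i, α i = f univ)).filter (fun α => ∀ S : Finset (Fin K), ∑ l ∈ S, α l ≤ f S),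
    ∀ β ∈ ((Fintype.piFinset fun _ : Fin K => Finset.range (f univ + 1)).filter
        (fun α => ∑ i, α i = f univ)).filter (fun α => ∀ S : Finset (Fin K), ∑ l ∈ S, α l ≤ f S),
    ∀ i : Fin K, β i < α i →
      ∃ j : Fin K, α j < β j ∧
        (α - Pi.single i 1 + Pi.single j 1) ∈
          ((Fintype.piFinset fun _ : Fin K => Finset.range (f univ + 1)).filter
            (fun α => ∑ i, α i = f univ)).filter (fun α => ∀ S : Finset (Fin K), ∑ l ∈ S, α l ≤ f S) ∧
        (β - Pi.single j 1 + Pi.single i 1) ∈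
          ((Fintype.piFinset fun _ : Fin K => Finset.range (f univ + 1)).filter
            (fun α => ∑ i, α i = f univ)).filter (fun α => ∀ S : Finset (Fin K), ∑ l ∈ S, α l ≤ f S) ∧
        (fun _ : Fin K → ℕ => (0 : ℚ)) (α - Pi.single i 1 + Pi.single j 1) +
            (fun _ : Fin K → ℕ => (0 : ℚ)) (β - Pi.single j 1 + Pi.single i 1) ≤
          (fun _ : Fin K → ℕ => (0 : ℚ)) α + (fun _ : Fin K → ℕ => (0 : ℚ)) β := by
  have hD : ∀ α : Fin K → ℕ, α ∈ ((Fintype.piFinset fun _ : Fin K => Finset.range (f univ + 1)).filter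
        (fun α => ∑ i, α i = f univ)).filter (fun α => ∀ S : Finset (Fin K), ∑ l ∈ S, α l ≤ f S) ↔
      (∀ S, ∑ l ∈ S, α l ≤ f S) ∧ ∑ l, α l = f univ := by
    intro α
    simp only [Finset.mem_filter, Fintype.mem_piFinset, Finset.mem_range]
    constructor
    · rintro ⟨⟨-, h2⟩, h3⟩
      exact ⟨h3, h2⟩
    · rintro ⟨h3, h2⟩
      refine ⟨⟨fun l => Nat.lt_succ_of_le ?_, h2⟩, h3⟩
      rw [← h2]
      exact Finset.single_le_sum (fun k _ => Nat.zero_le (α k)) (Finset.mem_univ l)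
  intro α hα β hβ i hi
  obtain ⟨j, hj, h1, h2⟩ := polymatroid_isMConvex f hsub h0 _ hD α hα β hβ i hi
  exact ⟨j, hj, h1, h2, by simp⟩

end DetLorentzian

end Summit.ValiantsHypothesis.ValiantsHypothesis.Theorems.LacunarySymmetroidMatrixDescartes
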